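import Summits.KontsevichZagierPeriods.KontsevichZagierPeriods.Theses.SymplecticScissors
import Literature.NumberTheory.Transcendental.AyoubPeriodSeries
import Summits.KontsevichZagierPeriods.KontsevichZagierPeriods.Theorems.UnfoldedStokesStokesGenerationStubSpanToRepsAuxCoeff
import Mathlib.RingTheory.MvPowerSeries.Order
import Mathlib.RingTheory.MvPowerSeries.Substitution
import Summits.KontsevichZagierPeriods.KontsevichZagierPeriods.Theorems.SymplecticScissorsTypeAGenerationStubPdzCalculus
import Summits.KontsevichZagierPeriods.KontsevichZagierPeriods.Theorems.SymplecticScissorsTypeAGenerationStubPdzMemOan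

/-!
# `TypeAGeneration` (stmt-KontsevichZagierPeriods-18392), line `Sketch`, stub `stub_covChainRule` (V2)

Crux `Summit.KontsevichZagierPeriods.KontsevichZagierPeriods.Theses.SymplecticScissors.TypeAGeneration`
(Ayoub 2015 Conj. 1.1 = Fresán 2024 Conj. 3.5), line `Sketch` (card stokes-compiler), engine
(C3, `n = 1`): change of variables in dimension one inside type (a) (Ayoub 2015 Rem. 1.5), along
the straight-line homotopy `H = zᵢ(1 − z_j) + u(zᵢ) z_j` between `zᵢ` and `u(zᵢ)`.

**Stub V2 — the formal chain rule.** For a series `g ∈ ℂ[[z]]` (`AyoubRel.CSeries`) involving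
only the variable `zᵢ` and the substitution `zᵢ ↦ H`, `z_l ↦ z_l` (`l ≠ i`)
(`MvPowerSeries.subst`), for every direction `l`:
`∂_l g(H) = g′(H) · ∂_l H` (`∂_l = AyoubRel.pdz l`, `g′ = ∂ᵢ g`).

Proof (coefficientwise finite sums, all `[folklore]`; no definition is introduced — `H` and the
substitution family are local notations):

* `v2_hasSubst`: the family is substitutable (`H` has no constant term, `v2_constantCoeff_covH`);
* `v2_coeff_pow_eq_zero`: `coeff_a (Hⁿ) = 0` for `n > |a|` (`MvPowerSeries.coeff_of_lt_order`);
* `v2_coeff_subst`: the **coefficient formula** `coeff_a g(H) = Σ_{n < N} g_n coeff_a (Hⁿ)` for any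
  `N > |a|` (in `MvPowerSeries.coeff_subst` only the exponents `n eᵢ` survive);
* the stub: `coeff_a` of both sides, using `∂_l (Hⁿ) = n Hⁿ⁻¹ ∂_l H` (`w2_map_pow` for the
  derivation `∂_l`, `w1_pdz_mul`, `w1_pdz_C`) read coefficientwise and `g′_m = (m + 1) g_{m+1}`.
-/

noncomputable section

-- `Summit.KontsevichZagierPeriods.KontsevichZagierPeriods.…` is the tree's mandated layout (single-conjunct summit).
set_option linter.dupNamespace false

namespace Summit.KontsevichZagierPeriods.KontsevichZagierPeriods.TypeAGenerationLine

open Finsupp MvPowerSeries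
open Literature.NumberTheory.Transcendental
open Literature.NumberTheory.Transcendental.AyoubRel
open Summit.KontsevichZagierPeriods.KontsevichZagierPeriods.Theses.SymplecticScissors (TypeAGeneration)

/-- The straight-line homotopy `H = zᵢ(1 − z_j) + u(zᵢ) z_j`. -/
local notation3 "covH[" i ", " j ", " u "]" =>
  ((X i : CSeries) * (1 - X j) + Polynomial.aeval (X i : CSeries) u * X j)

/-- The substitution family `zᵢ ↦ H`, `z_l ↦ z_l` (`l ≠ i`). -/
local notation3 "covFam[" i ", " j ", " u "]" =>
  (fun l : ℕ => if l = i then covH[i, j, u] else (X l : CSeries))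

/-! ## The substitution `zᵢ ↦ H` -/

/-- `H = zᵢ(1 − z_j) + u(zᵢ) z_j` has no constant term. [folklore] -/
theorem v2_constantCoeff_covH (i j : ℕ) (u : Polynomial ℂ) :
    constantCoeff (covH[i, j, u]) = 0 := by
  rw [map_add, map_mul, map_mul, constantCoeff_X, constantCoeff_X, zero_mul, mul_zero, add_zero]

/-- The family `(H; z_l for l ≠ i)` is substitutable (no constant terms; coefficientwise
finite). [folklore] -/
theorem v2_hasSubst (i j : ℕ) (u : Polynomial ℂ) : HasSubst covFam[i, j, u] := by
  classical
  refine ⟨fun l => ?_, fun d => ?_⟩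
  · have h0 : constantCoeff (covFam[i, j, u] l) = 0 := by
      show constantCoeff (if l = i then covH[i, j, u] else (X l : CSeries)) = 0
      split_ifs
      · exact v2_constantCoeff_covH i j u
      · exact constantCoeff_X l
    rw [h0]
    exact IsNilpotent.zero
  · refine (d.support.finite_toSet.union (Set.finite_singleton i)).subset fun l hl => ?_
    simp only [Set.mem_setOf_eq] at hl
    by_cases hli : l = i
    · exact Or.inr hli
    · left
      rw [if_neg hli, coeff_X] at hl
      split_ifs at hl with hd
      · rw [Finset.mem_coe, hd, mem_support_iff, single_eq_same]
        exact one_ne_zero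
      · exact absurd rfl hl

/-- `coeff_a (Hⁿ) = 0` for `n > |a|` (`H` has no constant term). [folklore] -/
theorem v2_coeff_pow_eq_zero (i j : ℕ) (u : Polynomial ℂ) {a : ℕ →₀ ℕ} {n : ℕ}
    (h : degree a < n) : coeff a (covH[i, j, u] ^ n) = 0 :=
  coeff_of_lt_order (lt_of_lt_of_le (Nat.cast_lt.mpr h)
    (le_order_pow_of_constantCoeff_eq_zero n (v2_constantCoeff_covH i j u)))

/-- `∏_s (a s)^{(n eᵢ) s} = Hⁿ` for the family `a = (H; z_l)`. [folklore] -/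
theorem v2_prod_single (i j : ℕ) (u : Polynomial ℂ) (n : ℕ) :
    ((single i n).prod fun s m => covFam[i, j, u] s ^ m) = covH[i, j, u] ^ n := by
  rw [Finsupp.prod_single_index (h := fun s m => covFam[i, j, u] s ^ m) (pow_zero _)]
  dsimp only
  rw [if_pos rfl]

/-- **Coefficient formula for `g(H)`**: for `g` involving only `zᵢ` and any `N > |a|`,
`coeff_a g(H) = Σ_{n < N} g_n · coeff_a (Hⁿ)` (only the exponents `n eᵢ`, `n ≤ |a|`, contribute to
`MvPowerSeries.coeff_subst`). [folklore] -/
theorem v2_coeff_subst (i j : ℕ) (u : Polynomial ℂ) {g : CSeries}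
    (hg : ∀ l : ℕ, UsesVar g l → l = i) (a : ℕ →₀ ℕ) {N : ℕ} (hN : degree a < N) :
    coeff a (subst covFam[i, j, u] g) =
      ∑ n ∈ Finset.range N, coeff (single i n) g * coeff a (covH[i, j, u] ^ n) := by
  classical
  rw [coeff_subst (v2_hasSubst i j u)]
  have hsupp : (Function.support fun d : ℕ →₀ ℕ =>
      coeff d g • coeff a (d.prod fun s m => covFam[i, j, u] s ^ m)) ⊆
      (((Finset.range N).image fun n => single i n : Finset (ℕ →₀ ℕ)) : Set (ℕ →₀ ℕ)) := by
    intro d hd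
    have hd' : coeff d g • coeff a (d.prod fun s m => covFam[i, j, u] s ^ m) ≠ 0 := hd
    have hg0 : coeff d g ≠ 0 := left_ne_zero_of_smul hd'
    have hds : d = single i (d i) := by
      ext l
      by_cases hl : l = i
      · rw [hl, single_eq_same]
      · rw [single_eq_of_ne hl]
        by_contra h0
        exact hl (hg l ⟨d, h0, hg0⟩)
    have hn : d i < N := by
      by_contra hle
      refine right_ne_zero_of_smul hd' ?_
      rw [hds, v2_prod_single]
      exact v2_coeff_pow_eq_zero i j u (lt_of_lt_of_le hN (not_lt.mp hle))
    rw [Finset.coe_image]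
    exact ⟨d i, Finset.mem_coe.mpr (Finset.mem_range.mpr hn), hds.symm⟩
  rw [finsum_eq_sum_of_support_subset _ hsupp, Finset.sum_image (single_injective i).injOn]
  refine Finset.sum_congr rfl fun n _ => ?_
  rw [v2_prod_single, smul_eq_mul]

/-! ## The registered stub -/

/-- **V2 — CHAIN RULE (formal).** For a one-variable `g` (variable `zᵢ`) and every direction `l`:
`∂_l g(H) = g′(H) · ∂_l H` for the substitution `zᵢ ↦ H = zᵢ(1 − z_j) + u(zᵢ)z_j` (coefficientwise
finite sums: `g(H) = Σ g_n Hⁿ`, `∂_l Hⁿ = n Hⁿ⁻¹ ∂_l H`). [folklore] -/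
theorem stub_covChainRule :
    ∀ (i j : ℕ), i ≠ j → ∀ (u : Polynomial ℂ) (g : CSeries), (∀ l : ℕ, UsesVar g l → l = i) →
      ∀ l : ℕ, pdz l (MvPowerSeries.subst covFam[i, j, u] g) =
        MvPowerSeries.subst covFam[i, j, u] (pdz i g) * pdz l (covH[i, j, u]) := by
  classical
  intro i j _ u g hg l
  have hg' : ∀ l' : ℕ, UsesVar (pdz i g) l' → l' = i := fun l' hl' => hg l' (w2_usesVar_pdz hl')
  have h1 : pdz l (1 : CSeries) = 0 := by
    have h := w1_pdz_C l 1
    rwa [map_one] at h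
  have hpow : ∀ n : ℕ, pdz l (covH[i, j, u] ^ n) =
      (n : CSeries) * covH[i, j, u] ^ (n - 1) * pdz l (covH[i, j, u]) :=
    w2_map_pow (D := pdz l) (w1_pdz_mul l) h1 _
  -- the term-by-term identity behind the chain rule
  have key : ∀ (a : ℕ →₀ ℕ) (m : ℕ),
      ((a l : ℂ) + 1) * (coeff (single i (m + 1)) g * coeff (a + single l 1) (covH[i, j, u] ^ (m + 1))) =
        coeff (single i m) (pdz i g) * coeff a (covH[i, j, u] ^ m * pdz l (covH[i, j, u])) := by
    intro a m
    have h2 : coeff (single i m) (pdz i g) = ((m : ℂ) + 1) * coeff (single i (m + 1)) g := by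
      rw [StokesGenerationLine.coeff_pdz, single_eq_same, ← single_add]
    have h3 : ((a l : ℂ) + 1) * coeff (a + single l 1) (covH[i, j, u] ^ (m + 1)) =
        ((m : ℂ) + 1) * coeff a (covH[i, j, u] ^ m * pdz l (covH[i, j, u])) := by
      rw [← StokesGenerationLine.coeff_pdz l (covH[i, j, u] ^ (m + 1)) a, hpow, Nat.add_sub_cancel,
        mul_assoc, ← map_natCast (C : ℂ →+* CSeries), coeff_C_mul, Nat.cast_succ]
    rw [h2, mul_left_comm, h3]
    ring
  refine MvPowerSeries.ext fun a => ?_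
  have hdeg : degree (a + single l 1) < degree a + 1 + 1 := by
    rw [map_add, degree_single]
    omega
  have hne : a + single l 1 ≠ 0 := fun h => by simpa using DFunLike.congr_fun h l
  rw [StokesGenerationLine.coeff_pdz, v2_coeff_subst i j u hg (a + single l 1) hdeg, Finset.mul_sum,
    Finset.sum_range_succ', pow_zero, coeff_one, if_neg hne, mul_zero, mul_zero, add_zero,
    coeff_mul]
  have hanti : ∀ p ∈ Finset.HasAntidiagonal.antidiagonal a,
      coeff p.1 (subst covFam[i, j, u] (pdz i g)) * coeff p.2 (pdz l (covH[i, j, u])) =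
        ∑ m ∈ Finset.range (degree a + 1),
          coeff (single i m) (pdz i g) * coeff p.1 (covH[i, j, u] ^ m) *
            coeff p.2 (pdz l (covH[i, j, u])) := by
    intro p hp
    have hp1 : degree p.1 < degree a + 1 := by
      rw [Finset.HasAntidiagonal.mem_antidiagonal] at hp
      rw [← hp, map_add]
      omega
    rw [v2_coeff_subst i j u hg' p.1 hp1, Finset.sum_mul]
  rw [Finset.sum_congr rfl hanti, Finset.sum_comm]
  refine Finset.sum_congr rfl fun m _ => ?_
  rw [key a m, coeff_mul, Finset.mul_sum]
  exact Finset.sum_congr rfl fun p _ => (mul_assoc _ _ _).symm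

end Summit.KontsevichZagierPeriods.KontsevichZagierPeriods.TypeAGenerationLine
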